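import Literature.MathematicalPhysics.QuantumFieldTheory.Balaban1983to89.B5Eq112TorusBridge
import Literature.MathematicalPhysics.QuantumFieldTheory.Balaban1983to89.B5Eq119GaussianV1

/-!
# `Balaban1983to89.B5Eq114TorusBridge` — T. Bałaban, *Propagators and renormalization transformations for lattice gauge
theories. I*, Commun. Math. Phys. **95** (1984) 17–40 [Balaban1984PropagatorsI], (1.14) p. 19: «(Te^{−S})(B) = Z^{(0)} exp(−½⟨B, Δ₁B⟩)»
— the two formalizations of `Z^{(0)}` and `Δ₁` in the tree are ONE object: seat p38's V1 `B5Eq119GaussianV1.zAx P 1`/`DeltaK P 1`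
(for the declaration of record `B5Eq112RenormTransf.renormTransf`) versus the B5 owner's torus `B5Eq114Gauss.Z0`/`Delta1` (for the twin
`B5SectBStatements.rt12`), through the (1.12) bridge `B5Eq112TorusBridge`

statement-level skeleton of published theorems with citation tags; proofs where landed; nothing here is a claim about the Yang–Mills mass gap

PDF held: `paper:balaban1984-cmp95-propagators-rt-i` (journal page = PDF page + 16); p. 19 [PDF 3] read from the materialised text
`~/.lit/texts/paper-balaban1984-cmp95-propagators-rt-i/p0003.txt` (and the ×2 render
`run/shared/lean/pub/pub-balaban/b2b-balaban-ref1/pages/1984-cmp95-propagators-rt-I/1984-cmp95-propagators-rt-I-p003-x2.png`).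

PRINT, verbatim (p. 19): *"The integral in (1.12) is obviously a Gaussian integral. We will prove later that the quadratic form ⟨∂A, ∂A⟩
is positive on the subspace of A satisfying QA = 0, A(Γ_{y,x}) = 0, x∈B(y), y∈T_L^{(1)}. A result of the integration is obviously a
Gaussian density (Te^{−S})(B) = Z^{(0)} exp(−½⟨B, Δ₁B⟩) = Z^{(0)} exp(−S₁(B)). (1.14)"*

CITATION HEADER (lean-in-tree rule) — WHAT IS REPRODUCED.  SKELETON rows `B5.Eq1.14` (fold owner r02: «proved p245722
(`B5Eq114Gauss.eq114_holds`, d ≥ 2) · V1 twin proved p248789 (`B5Eq119GaussianV1.eq114`)») and `B5.Eq1.12` (bridge p250577 + p250956,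
this seat): KNITTING of the two PROVED (1.14)'s.  On the unit step `T^{(0)} → T^{(1)}` of `Setup` (V1 level `j = 0`, block size `L`,
coarse torus `Mc P 0`), for the unit-lattice action (1.5) (`curlAction 1 1` on V1 = `action1` on the torus, `B5Eq112TorusCarriers.actionS_trV`):
* V1 (p38): `renormTransf (curlAction 1 1) B = zAx P 1 1 1 · exp(−½ B⬝(DeltaK P 1 1 1)B)` (`B5Eq119GaussianV1.eq114`), `Z = (Te^{−S})(0)`,
  `Δ₁ = W₁ᵀW₁` a real symmetric matrix on `PBond P 1`;
* torus (r02): `rt12 L M B = Z0 L M · exp(−S1 M (Delta1 L M) B)` (`B5Eq114Gauss.rt12_gauss`), `S1 M Δ B = ½⟨B, ΔB⟩`, `Delta1 = W^†W` a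
  symmetric linear map of `Fld M`.
WHAT IS PROVED (kernel, no `sorry`, standard axioms; `1 ≤ m + K`, every `d ≥ 1`, odd `L > 1`):
* `zAx_eq_const_mul_Z0` — `Z_{1,Ax}^{V1} = c · Z^{(0)}_{torus}` with THE constant `c > 0` of the (1.12) bridge (the Gaussian identity
  at `B = 0`); whence `Z0_pos_all_d : 0 < B5Eq114Gauss.Z0 L (Mc P 0)` for EVERY `d ≥ 1` (the torus file has it for `d ≥ 2` via the
  p. 19 positivity; here it is inherited from p38's V1 `zAx_pos`);
* `dotProduct_DeltaK_eq_inner_Delta1` — the two quadratic forms `⟨B, Δ₁B⟩` AGREE: `B ⬝ᵥ (DeltaK P 1 1 1 *ᵥ B) = ⟪trB B, Delta1 L Mc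
  (trB B)⟫` (divide the bridged Gaussians by their values at `0`, `exp` injective);
* `trB_DeltaK_mulVec` — **the two operators `Δ₁` AGREE**: `trB (DeltaK P 1 1 1 *ᵥ B) = Delta1 L (Mc P 0) (trB B)` for every `B`
  (polarization of the two symmetric forms + `⟪trB x, trB y⟫ = x ⬝ᵥ y`).
HONEST SCOPE.  Unit action only (`w = 1`, lattice factor `1` — the objects `Z0`/`Delta1`/`rt12` of the torus file are typed for (1.5));
one step (`k = 1`; the k-fold (1.19) dictionary `B5Eq119GaussianV1.DeltaK P k` ↔ `B5Eq114Gauss.DeltaK L M k` needs the (1.17) tower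
knitting, not done here); the constant `c` is the slice Jacobian of `B5Eq112TorusBridge`, existential.  Theorems only; no new definitions,
no `def … : Prop`.

Unit `lit-balaban-p16` gen 3 (Phase-2 proof seat p16; literature-prover-lit-balaban-p16-g3-0), HOME `run/shared/lean/pub/lit-balaban/`
(STATUS: `lit-balaban-p16/STATUS.md`), 2026-08-21.
-/

open scoped BigOperators Matrix RealInnerProductSpace

namespace Literature.MathematicalPhysics.QuantumFieldTheory.Balaban1983to89

namespace B5Eq114TorusBridge

open LatticeFieldCalculus B5SectBStatements B5Eq112TorusCarriers B5Eq112TorusBridge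
open B5Prop11Plancherel (Tor fine)
open B5Eq112RenormTransf (renormTransf)
open B5Eq119GaussianV1 (zAx DeltaK zAx_pos DeltaK_isSymm)
open B5Eq114Gauss (Z0 Delta1 rt12_gauss Delta1_symm)

noncomputable section

variable {P : Params}

/-! ## §1  The two Gaussians (1.14) through the (1.12) bridge -/

/-- `trB 0 = 0` and the inner products of transported block fields are the dot products: `⟪trB x, trB y⟫ = x ⬝ᵥ y`.
[cite: Balaban1984PropagatorsI, (1.14) p.19] -/
theorem inner_trB (x y : VecField P 1 ℝ) : ⟪trB (P := P) (j := 0) x, trB y⟫ = x ⬝ᵥ y := by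
  rw [PiLp.inner_apply, dotProduct]
  exact Fintype.sum_equiv (bondEquiv (P := P) (j := 0 + 1)) _ _ fun i => by
    simp only [trB_apply, RCLike.inner_apply, conj_trivial, bondEquiv, Equiv.coe_fn_mk, mul_comm]

/-- **(1.14) BRIDGED**: with THE constant `c > 0` of the (1.12) bridge, for every block field `B`,
`Z_{1,Ax}·exp(−½ B⬝Δ₁^{V1}B) = c·Z^{(0)}·exp(−½⟪trB B, Δ₁^{torus} trB B⟫)` — p38's `eq114` and r02's `rt12_gauss` are the two sides of
`B5Eq112TorusBridge.renormTransf_eq_const_mul_rt12`. [cite: Balaban1984PropagatorsI, (1.14) p.19] -/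
theorem gauss_bridge (h1 : 1 ≤ P.m + P.K) :
    ∃ c : ℝ, 0 < c ∧ ∀ B : VecField P 1 ℝ,
      zAx P 1 1 1 * Real.exp (-(1 / 2) * (B ⬝ᵥ (DeltaK P 1 1 1 *ᵥ B)))
        = c * (Z0 P.L (Mc P 0) * Real.exp (-S1 (Mc P 0) (Delta1 P.L (Mc P 0)) (trB B))) := by
  obtain ⟨c, hc, h⟩ := renormTransf_eq_const_mul_rt12 (P := P) (j := 0) h1
  refine ⟨c, hc, fun B => ?_⟩
  rw [← B5Eq119GaussianV1.eq114 h1 one_pos one_ne_zero B, ← rt12_gauss, h B]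

/-- **`Z_{1,Ax}^{V1} = c·Z^{(0)}_{torus}`** (the bridged (1.14) at `B = 0`). [cite: Balaban1984PropagatorsI, (1.14) p.19] -/
theorem zAx_eq_const_mul_Z0 (h1 : 1 ≤ P.m + P.K) :
    ∃ c : ℝ, 0 < c ∧ zAx P 1 1 1 = c * Z0 P.L (Mc P 0) ∧ ∀ B : VecField P 1 ℝ,
      zAx P 1 1 1 * Real.exp (-(1 / 2) * (B ⬝ᵥ (DeltaK P 1 1 1 *ᵥ B)))
        = c * (Z0 P.L (Mc P 0) * Real.exp (-S1 (Mc P 0) (Delta1 P.L (Mc P 0)) (trB B))) := by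
  obtain ⟨c, hc, h⟩ := gauss_bridge (P := P) h1
  refine ⟨c, hc, ?_, h⟩
  have h0 := h 0
  simp only [map_zero, S1, inner_zero_left, mul_zero, Matrix.mulVec_zero, dotProduct_zero, neg_zero,
    Real.exp_zero, mul_one] at h0
  exact h0

/-- **`Z^{(0)} > 0` on the torus carrier for EVERY `d ≥ 1`** (inherited from p38's V1 `zAx_pos` through the bridge; the torus file's
`B5Eq114Gauss.Z0_pos` covers `d ≥ 2`). [cite: Balaban1984PropagatorsI, (1.14) p.19] -/
theorem Z0_pos_all_d (h1 : 1 ≤ P.m + P.K) : 0 < Z0 P.L (Mc P 0) := by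
  obtain ⟨c, hc, h0, -⟩ := zAx_eq_const_mul_Z0 (P := P) h1
  have hz : 0 < zAx P 1 1 1 := zAx_pos (P := P) (k := 1) h1 one_pos one_ne_zero
  rw [h0] at hz
  exact pos_of_mul_pos_right hz hc.le

/-- **the two quadratic forms `⟨B, Δ₁B⟩` of (1.14) agree**: `B ⬝ᵥ (Δ₁^{V1} B) = ⟪trB B, Δ₁^{torus}(trB B)⟫`.
[cite: Balaban1984PropagatorsI, (1.14) p.19] -/
theorem dotProduct_DeltaK_eq_inner_Delta1 (h1 : 1 ≤ P.m + P.K) (B : VecField P 1 ℝ) :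
    B ⬝ᵥ (DeltaK P 1 1 1 *ᵥ B) = ⟪trB (P := P) (j := 0) B, Delta1 P.L (Mc P 0) (trB B)⟫ := by
  obtain ⟨c, hc, h0, h⟩ := zAx_eq_const_mul_Z0 (P := P) h1
  have hZ : 0 < Z0 P.L (Mc P 0) := Z0_pos_all_d (P := P) h1
  have hB := h B
  rw [h0, mul_assoc] at hB
  have hB' := mul_left_cancel₀ hZ.ne' (mul_left_cancel₀ hc.ne' hB)
  have hexp := Real.exp_injective hB'
  simp only [S1] at hexp
  linarith

/-! ## §2  The two operators `Δ₁` agree (polarization) -/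

/-- symmetry of the V1 form: `x ⬝ᵥ (Δ y) = y ⬝ᵥ (Δ x)` (`DeltaK_isSymm`). [cite: Balaban1984PropagatorsI, (1.14) p.19] -/
theorem dotProduct_DeltaK_comm (x y : VecField P 1 ℝ) :
    x ⬝ᵥ (DeltaK P 1 1 1 *ᵥ y) = y ⬝ᵥ (DeltaK P 1 1 1 *ᵥ x) := by
  have hs : (DeltaK P 1 1 1)ᵀ = DeltaK P 1 1 1 := DeltaK_isSymm (P := P) 1 1 1
  rw [Matrix.dotProduct_mulVec, ← Matrix.mulVec_transpose, hs, dotProduct_comm]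

/-- **THE TWO `Δ₁` ARE ONE OPERATOR**: `trB (Δ₁^{V1} B) = Δ₁^{torus} (trB B)` — p38's matrix `B5Eq119GaussianV1.DeltaK P 1 1 1` on
`PBond P 1` and the B5 owner's `B5Eq114Gauss.Delta1 L (Mc P 0)` on `Fld (Mc P 0)` are conjugate under the transport `trB` (polarization of
`dotProduct_DeltaK_eq_inner_Delta1`, both forms symmetric). [cite: Balaban1984PropagatorsI, (1.14) p.19] -/
theorem trB_DeltaK_mulVec (h1 : 1 ≤ P.m + P.K) (B : VecField P 1 ℝ) :
    trB (P := P) (j := 0) (DeltaK P 1 1 1 *ᵥ B) = Delta1 P.L (Mc P 0) (trB B) := by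
  -- polarization: the symmetric bilinear forms agree because their quadratic forms do
  have hbil : ∀ x y : VecField P 1 ℝ,
      x ⬝ᵥ (DeltaK P 1 1 1 *ᵥ y) = ⟪trB (P := P) (j := 0) x, Delta1 P.L (Mc P 0) (trB y)⟫ := by
    intro x y
    have hq := dotProduct_DeltaK_eq_inner_Delta1 (P := P) h1 (x + y)
    have hx := dotProduct_DeltaK_eq_inner_Delta1 (P := P) h1 x
    have hy := dotProduct_DeltaK_eq_inner_Delta1 (P := P) h1 y
    rw [Matrix.mulVec_add, add_dotProduct, dotProduct_add, dotProduct_add, dotProduct_DeltaK_comm y x, map_add, map_add,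
      inner_add_left, inner_add_right, inner_add_right, ← Delta1_symm P.L (Mc P 0) (trB y) (trB x),
      real_inner_comm (trB x)] at hq
    linarith
  apply ext_inner_left ℝ
  intro v
  obtain ⟨x, rfl⟩ := (trB (P := P) (j := 0)).surjective v
  rw [inner_trB, hbil]

end

end B5Eq114TorusBridge

end Literature.MathematicalPhysics.QuantumFieldTheory.Balaban1983to89
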